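import Summits.RiemannHypothesis.RiemannHypothesis.Theorems.ThetaTier2Row
import HarnessLib

/-!
# THETA tier-2 kernel checker — the ROW: atom table, closed forms of the composite fields, outward rounding (cc-s2-1; RH-FREE)

§6(e) of HOME/cc-s2-1/gen22/TIER2-KERNEL-SPEC.md, part 2 of 3 (reading aid + lemmas for `ThetaTier2RowSound`): the thirty atom values
(`vals_table`), each composite `RExpr` field of `ThetaTier2Row` evaluated in closed form (`eval_eTh0 = th0R`, `eval_eM0 = M0R`, …, i.e. the
reals of `Row2.real`), and the outward-rounding lemmas of the `2⁹⁶` grid (`le_val_upQ`, `val_upQ_le`, `val_dnQ_le`, `le_val_dnQ`,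
`val_dnQ_le_of_le`, `le_val_hiOf`, `val_loOf_le`, `getD_map_range`).  Nothing here bears on the truth of RH.
-/

set_option linter.dupNamespace false  -- the mandated namespace repeats `RiemannHypothesis`
set_option autoImplicit false

namespace Summit.RiemannHypothesis.RiemannHypothesis.Theorems.ThetaTier2

open Literature.Analysis.ValidatedNumerics
open ThetaTier1 (Atom IH Rtop zetaHi pLamHi GAMMA_LO PREC HERON rpow eval_rpow enclList xOf valOf mem_xOf_of_enclList)
open Real

namespace Row2

variable (r : Row2)

/-! ## The atom table and the closed forms of the composite fields -/

/-- The thirty atom values. [this cell] -/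
theorem vals_table :
    r.vals 0 = π ∧ r.vals 1 = Real.log 2 ∧ r.vals 2 = Real.log (4 * π) ∧ r.vals 3 = exp ((1 / 2 : ℚ) : ℝ) ∧
    r.vals 4 = exp ((-1 / 2 : ℚ) : ℝ) ∧ r.vals 5 = exp ((-5 / 2 : ℚ) : ℝ) ∧ r.vals 6 = exp ((-9 / 2 : ℚ) : ℝ) ∧
    r.vals 7 = exp ((-13 / 2 : ℚ) : ℝ) ∧ r.vals 8 = exp ((-17 / 2 : ℚ) : ℝ) ∧ r.vals 9 = exp ((-21 / 2 : ℚ) : ℝ) ∧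
    r.vals 10 = exp ((-25 / 2 : ℚ) : ℝ) ∧ r.vals 11 = exp ((-2 : ℚ) : ℝ) ∧ r.vals 12 = exp ((TAU : ℚ) : ℝ) ∧
    r.vals 13 = exp ((-(r.m + 1 / 2) * TAU : ℚ) : ℝ) ∧ r.vals 14 = exp ((-(r.m : ℚ) * TAU : ℚ) : ℝ) ∧
    r.vals 15 = exp ((-(r.m - 1 : ℚ) * TAU : ℚ) : ℝ) ∧ r.vals 16 = exp ((-TAU / 2 : ℚ) : ℝ) ∧
    r.vals 17 = exp ((-(2 * r.m + 1 : ℚ) * DEPTH : ℚ) : ℝ) ∧ r.vals 18 = exp ((-(2 * r.m : ℚ) * DEPTH : ℚ) : ℝ) ∧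
    r.vals 19 = exp ((-(2 * r.m - 1 : ℚ) * DEPTH : ℚ) : ℝ) ∧ r.vals 20 = exp ((2 * r.delta - r.eta : ℚ) : ℝ) ∧
    r.vals 21 = exp ((r.eta - r.delta : ℚ) : ℝ) ∧ r.vals 22 = exp ((r.delta : ℚ) : ℝ) ∧ r.vals 23 = exp ((r.t0 / 2 : ℚ) : ℝ) ∧
    r.vals 24 = exp ((-(r.m + 1 : ℚ) * WL : ℚ) : ℝ) ∧ r.vals 25 = exp ((-(r.m : ℚ) * WL : ℚ) : ℝ) ∧
    r.vals 26 = exp ((r.m * (2 * r.delta - r.eta) : ℚ) : ℝ) ∧ r.vals 27 = exp ((2 * r.delta : ℚ) : ℝ) ∧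
    r.vals 28 = Real.log r.q ∧ r.vals 29 = Real.sqrt r.q := by
  simp [vals, ThetaTier1.valOf, atoms, ThetaTier1.Atom.val]

/-- `ζ*` in closed form. [this cell] -/
theorem eval_eZs : r.eZs.eval r.vals = r.zsR := by
  obtain ⟨h0, -, -, -, -, -, -, -, -, -, -, -, -, -, -, -, -, -, -, -, h20, -⟩ := r.vals_table
  simp only [eZs, RExpr.eval, h0, h20, zsR]; push_cast; ring

/-- `θ₀` in closed form. [this cell] -/
theorem eval_eTh0 : r.eTh0.eval r.vals = r.th0R := by
  simp only [eTh0, RExpr.eval, eval_eZs, th0R]; push_cast; ring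

/-- `(m/ζ*)^m` in closed form. [this cell] -/
theorem eval_eRatM : r.eRatM.eval r.vals = r.ratMR := by
  unfold eRatM; rw [eval_rpow]; simp only [RExpr.eval, eval_eZs, ratMR]; push_cast; ring

/-- `M₀` in closed form. [this cell] -/
theorem eval_eM0 : r.eM0.eval r.vals = r.M0R := by
  obtain ⟨h0, -⟩ := r.vals_table
  simp only [eM0, RExpr.eval, eval_eRatM, h0, M0R]

/-- `M̄` in closed form. [this cell] -/
theorem eval_eMbar : r.eMbar.eval r.vals = r.M0R * (zetaHi (r.m + 1) : ℝ) := by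
  simp only [eMbar, RExpr.eval, eval_eM0]

/-- `u₁` in closed form. [this cell] -/
theorem eval_eU1 : r.eU1.eval r.vals = exp ((r.eta - r.delta : ℚ) : ℝ) * (Real.sqrt r.q)⁻¹ := by
  obtain ⟨-, -, -, -, -, -, -, -, -, -, -, -, -, -, -, -, -, -, -, -, -, h21, -, -, -, -, -, -, -, h29⟩ := r.vals_table
  simp only [eU1, RExpr.eval, h21, h29]

/-- `M₁₀` in closed form. [this cell] -/
theorem eval_eM10 : r.eM10.eval r.vals = r.M10R := by
  obtain ⟨-, -, -, -, -, -, -, -, -, -, -, -, -, -, -, -, -, -, -, -, h20, -⟩ := r.vals_table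
  simp only [eM10, RExpr.eval, eval_eRatM, h20, M10R]

/-- `M̄₁` in closed form. [this cell] -/
theorem eval_eMbar1 : r.eMbar1.eval r.vals = r.M10R * ((zetaHi r.m : ℝ) * ((r.c2 : ℝ) + (r.eps : ℝ) * (1 + r.th0R⁻¹))) := by
  simp only [eMbar1, RExpr.eval, eval_eM10, eval_eTh0]; push_cast; ring

/-- `J⁺(t₀)` in closed form. [this cell] -/
theorem eval_eJ : r.eJ.eval r.vals = r.JR := by
  obtain ⟨-, h1, -, h3, h4, h5, h6, h7, h8, h9, h10, h11, -⟩ := r.vals_table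
  simp only [eJ, RExpr.eval, h1, h3, h4, h5, h6, h7, h8, h9, h10, h11, JR]; push_cast; ring

/-- `coefA` in closed form. [this cell] -/
theorem eval_eCoefA : r.eCoefA.eval r.vals = r.real.cA := by
  obtain ⟨h0, h1, h2, -⟩ := r.vals_table
  simp only [eCoefA, RExpr.eval, eval_eJ, h0, h1, h2, real]; push_cast; ring_nf

/-- `GtailW` in closed form. [this cell] -/
theorem eval_eGtail : r.eGtail.eval r.vals = r.real.Gt := by
  obtain ⟨-, -, -, -, -, -, -, -, -, -, -, -, -, -, -, -, -, -, -, -, -, -, -, -, h24, -⟩ := r.vals_table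
  simp only [eGtail, RExpr.eval, h24, real]

/-- `tailInt` in closed form. [this cell] -/
theorem eval_eTailInt : r.eTailInt.eval r.vals = r.real.T := by
  obtain ⟨-, -, -, -, -, -, -, -, -, -, -, -, -, -, -, -, -, -, -, -, -, -, -, -, -, h25, -⟩ := r.vals_table
  simp only [eTailInt, RExpr.eval, h25, real]

/-- `C(N)` in closed form. [this cell] -/
theorem eval_eCpsi : r.eCpsi.eval r.vals = r.real.C := by
  obtain ⟨-, h1, -, -, -, -, -, -, -, -, -, -, -, -, -, -, -, -, -, -, -, h21, -, -, -, -, -, -, h28, h29⟩ := r.vals_table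
  simp only [eCpsi, RExpr.eval, h1, h21, h28, h29, real]; push_cast; ring

/-- `rA` in closed form. [this cell] -/
theorem eval_eRA : r.eRA.eval r.vals = r.real.ra := by
  obtain ⟨-, -, -, -, -, -, -, -, -, -, -, -, -, -, -, -, -, -, -, -, -, -, h22, -⟩ := r.vals_table
  simp only [eRA, RExpr.eval, h22, real]

/-- `rB` in closed form. [this cell] -/
theorem eval_eRB : r.eRB.eval r.vals = r.real.rb := by
  obtain ⟨-, -, -, -, -, -, -, -, -, -, -, -, -, -, -, -, -, -, -, -, -, -, h22, -, -, -, -, -, -, h29⟩ := r.vals_table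
  simp only [eRB, RExpr.eval, h22, h29, real]

/-- `2 log q/√q` in closed form. [this cell] -/
theorem eval_eRcoef : r.eRcoef.eval r.vals = r.real.rc := by
  obtain ⟨-, -, -, -, -, -, -, -, -, -, -, -, -, -, -, -, -, -, -, -, -, -, -, -, -, -, -, -, h28, h29⟩ := r.vals_table
  simp only [eRcoef, RExpr.eval, h28, h29, real]; push_cast; ring

/-! ## Outward rounding -/

/-- `x ≤ val (upQ x)`. [this cell] -/
theorem le_val_upQ (x : ℚ) : (x : ℝ) ≤ val (upQ x) := by
  have hS : (0 : ℝ) < (S : ℝ) := by rw [S_cast_eq]; positivity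
  unfold val upQ
  rw [le_div_iff₀ hS]
  exact_mod_cast Nat.le_ceil (x * (S : ℚ))

/-- `val (upQ x) ≤ x + 1/S` for `x ≥ 0`. [this cell] -/
theorem val_upQ_le (x : ℚ) (hx : 0 ≤ x) : val (upQ x) ≤ x + 1 / (S : ℝ) := by
  have hS : (0 : ℝ) < (S : ℝ) := by rw [S_cast_eq]; positivity
  unfold val upQ
  rw [div_le_iff₀ hS, show ((x : ℝ) + 1 / (S : ℝ)) * (S : ℝ) = (x : ℝ) * S + 1 by field_simp]
  have h : ((⌈x * (S : ℚ)⌉₊ : ℕ) : ℚ) < x * S + 1 := Nat.ceil_lt_add_one (mul_nonneg hx (Nat.cast_nonneg _))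
  have h' : ((⌈x * (S : ℚ)⌉₊ : ℕ) : ℝ) < (x : ℝ) * S + 1 := by exact_mod_cast h
  exact h'.le

/-- `val (dnQ x) ≤ x` for `x ≥ 0`. [this cell] -/
theorem val_dnQ_le {x : ℚ} (hx : 0 ≤ x) : val (dnQ x) ≤ x := by
  have hS : (0 : ℝ) < (S : ℝ) := by rw [S_cast_eq]; positivity
  unfold val dnQ
  rw [div_le_iff₀ hS]
  exact_mod_cast Nat.floor_le (mul_nonneg hx (Nat.cast_nonneg _))

/-- `x − 1/S ≤ val (dnQ x)`. [this cell] -/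
theorem le_val_dnQ (x : ℚ) : (x : ℝ) - 1 / (S : ℝ) ≤ val (dnQ x) := by
  have hS : (0 : ℝ) < (S : ℝ) := by rw [S_cast_eq]; positivity
  unfold val dnQ
  rw [le_div_iff₀ hS, show ((x : ℝ) - 1 / (S : ℝ)) * (S : ℝ) = (x : ℝ) * S - 1 by field_simp]
  have h : x * S < ((⌊x * (S : ℚ)⌋₊ : ℕ) : ℚ) + 1 := Nat.lt_floor_add_one _
  have h' : (x : ℝ) * S < ((⌊x * (S : ℚ)⌋₊ : ℕ) : ℝ) + 1 := by exact_mod_cast h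
  linarith

/-- `val (dnQ x) ≤ y` whenever `x ≤ y` and `0 ≤ y` (the floor of a negative is `0`). [this cell] -/
theorem val_dnQ_le_of_le {x : ℚ} {y : ℝ} (hxy : (x : ℝ) ≤ y) (hy : 0 ≤ y) : val (dnQ x) ≤ y := by
  by_cases hx : 0 ≤ x
  · exact (val_dnQ_le hx).trans hxy
  · have : dnQ x = 0 :=
      Nat.floor_of_nonpos (mul_nonpos_of_nonpos_of_nonneg (not_le.1 hx).le (Nat.cast_nonneg _))
    rw [this, val_zero]; exact hy

/-- Upper enclosure ⇒ grid upper bound. [this cell] -/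
theorem le_val_hiOf {o : Option (NonemptyInterval ℚ)} {x : ℝ} {I : NonemptyInterval ℚ} (h : o = some I)
    (hx : x ∈ I.ratCast ℝ) : x ≤ val (hiOf o) := by
  subst h
  rw [NonemptyInterval.mem_ratCast_iff] at hx
  exact hx.2.trans (le_val_upQ _)

/-- Lower enclosure of a nonnegative real ⇒ grid lower bound. [this cell] -/
theorem val_loOf_le {o : Option (NonemptyInterval ℚ)} {x : ℝ} {I : NonemptyInterval ℚ} (h : o = some I)
    (hx : x ∈ I.ratCast ℝ) (h0 : 0 ≤ x) : val (loOf o) ≤ x := by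
  subst h
  rw [NonemptyInterval.mem_ratCast_iff] at hx
  exact val_dnQ_le_of_le hx.1 h0

/-- A mapped range read by `getD`. [folklore] -/
theorem getD_map_range {α : Type*} (f : ℕ → α) (n j : ℕ) (d : α) (hj : j < n) : ((List.range n).map f).getD j d = f j := by
  rw [List.getD_eq_getElem?_getD, List.getElem?_map, List.getElem?_range hj]; rfl

end Row2

end Summit.RiemannHypothesis.RiemannHypothesis.Theorems.ThetaTier2
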